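import Summits.QuantumFields.YangMills.Theorems.UnitScaleTiltProp7BlockPoincareTopMeanKeptSocket
import HarnessLib

/-!
# Route `UnitScaleTilt`, crux «MinimiserStabilityRegPr» (stmt-QuantumFields-19200, stub EX), positivity block, the LOD ∕ Combes–Thomas line of ★p1 g24's
# `LOCATE-P349-CT` v2 §7 (E2) (★★OWNER RULINGS №33∕№34) — **BRICK (L2′-GAP), FILE 2∕2: THE MASSIVE COVARIANT OPERATOR `Δ′_a = Δ_U + aQ″†Q″` HAS A K-UNIFORM GAP ON
# ALL `λ`, i.e. THE BLOCK COVARIANT POINCARÉ INEQUALITY WITH THE TOP NESTED COVARIANT MEAN KEPT** — for EVERY top nested covariant mean `Q″` OF RECORD (clauses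
# (iii)+(iv) of ✓`Prop7NSIntertwinerOfRecord.exists_intertwiner_of_regPr`) and every printed-regular background `U₀ ∈ 𝔘_k(ε₀)`:
# `‖toL2S λ‖² ≤ 2·‖D^η_{U₀}(toL2S λ)‖² + 16·c₀·(L^{K−n})³·Σ_y ‖(Q″(toL2S λ))(y)‖²` for ALL `λ` (ym3-torus-px5 g11, `LOCATE-L2gap-px5g11.md`; (L1) ✓p746531 is the case `Q″λ = 0`).

Cell `ym3-torus` (HUMAN RULING D-0037: YM₃ on T³ is ladder rung R3 — NOT d = 4, NOT infinite volume, NOT a mass gap, NOT Clay).  Width seat `ym3-torus-px5` (gen 11; WIDTH COPY of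
ym3-torus-p1).  THEOREMS ONLY (0 `def`, 0 `sorry`); `--supports stmt-QuantumFields-19200 --as helper`, count-neutral.  HONEST LABEL (№33 (6)∕№34): «curved γ-row supplier line (LOD
localisation); one Thm 3.1-class Agmon brick (L3′) inside, Track A road cited; nothing of EX∕19200 proved».

THE POINT.  The repaired line (memo §7 (E2) = print's (3.25): `P = 1 − R = G_aQ″†(Q″G_a²Q″†)⁻¹Q″G_a`, `G_a := (Δ_U + aQ″†Q″)⁻¹`) starts from the EXISTENCE of `G_a` with a
K-UNIFORM bound `‖G_a‖ ≤ 1∕m` — print's `Δ′_a ≥ γ₀` ([Balaban1983RegularityDecay] (1.8) p.573: «the constant `γ₀` is independent of the lattice spacing `η`, as well as of `Ω` and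
of `A`»; Prop 3.1′ (1.22) p.574; [Balaban1985BackgroundPropagators] (3.24) p.394, Thm 3.11 p.416 «`Δ′_a, G′, (Q′G′²Q′*)⁻¹` … are positive definite»).  In the lane's weighted letters
(`‖toL2S l‖² = c₀ΣΣ|l_{jk}|²`, `‖D^η(toL2S l)‖² = c₀η⁻²Σ_b‖U₀(b)l(b₊)U₀(b)⋆ − l(b₋)‖²_F`) the natural coarse weight is `c₀η⁻³` (the fine norm of the block-constant lift; `= 1` at
print's `c₀ = η³`, unit coarse lattice), and the row reads `‖λ‖² ≤ 2‖D_Uλ‖² + 16·[c₀η⁻³Σ_y‖(Q″λ)_y‖²]`, i.e. `Δ′_a ≥ min(½, a∕16)` — constants free of `L`, of `k = K − n`, of the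
volume.  WHY NOT «(L1) ⊕ mass» in two lines: the orthogonal split `λ = P_Nλ + (1 − P_N)λ` leaves a cross term `2re⟨D P_Nλ, D(1 − P_N)λ⟩` controlled only through `‖D^η‖ ~ η⁻¹`.
The KEPT-MEAN Poincaré has no split: ✓`Prop7NestedMeanPoincare.sum_normSq_le_combMean_add_covGrad` keeps the COMB mean, and the SAME tower induction (L1) uses
(✓`norm_ns_sub_refMean_le_of_lt`) bounds the comb mean by the nested mean PLUS the `δ`-small block mass; the reference swap then costs `2δ²` instead of `δ²`.

WHAT IS PROVED (sorry-free, no definition; ns `…Theorems.Prop7BlockPoincareTopMeanKept`; engines = FILE 1∕2 `…TopMeanKeptSocket`: ✓`sum_normSq_le_covGrad_add_of_combMean_le`,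
✓`norm_combSum_le_add_of_ns`, ✓`normSq_toL2S_le_two_mul_add_of_combMean_le`, ✓`window8_T3`).
* §3 (T³ member) ★★`normSq_toL2S_le_two_mul_add_of_ns` (tower-closeness data displayed, as ✓`…Bridge` §4, NO `hker`), ★★`normSq_toL2S_le_two_mul_add_of_nsTop` (ROW-T plugged:
  `RegPr`, `10⁷L³ε₀ ≤ 1` only).
* §4 ★★★`normSq_le_two_mul_normSq_DL2_add_topMean` — THE DISPLAY, in the `Q''`-currency of ✓p746531 (`hseq` verbatim); ★`normSq_le_two_mul_normSq_DL2_add_topMean_frob`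
  (Frobenius twin on the coarse side); ★★`gap_of_topMean` (`min(½, a∕16)`-form: `‖toL2S λ‖² ≤ max(2, 16c₀(L^{K−n})³∕a)·(‖DL2 …‖² + a·Σ_y‖Q''… y‖²)`).
HONEST SCOPE.  Finite-sum bookkeeping over landed rows; no operator `G_a`, no decay, no `Q″†` letter (no inner product of record on the coarse side yet — the sums are displayed);
nothing of (L3′)–(L5′), (3.49), Thm 3.1∕3.3∕3.11, `h349`, `hGF`, EX or the crux is proved here; nothing continuum ∕ OS ∕ mass-gap ∕ Clay.

References: T. Bałaban, CMP **89** (1983) 571–597 [Balaban1983RegularityDecay] ((1.8) p.573, Prop 3.1′ (1.22) p.574, (2.27) p.580); CMP **99** (1985) 389–434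
[Balaban1985BackgroundPropagators] ((3.19) p.393, (3.24)–(3.25) p.394, Thm 3.11 p.416); CMP **95** (1984) 17–40 [Balaban1984PropagatorsI] ((1.42)–(1.44) pp.25–26);
CMP **98** (1985) 17–51 [Balaban1985Averaging] ((97) p.32, pp.24–25); CMP **102** (1985) 277–309 [Balaban1985Variational] ((2) p.278).
-/

set_option autoImplicit false

noncomputable section

open scoped BigOperators Matrix.Norms.L2Operator

namespace Summit.QuantumFields.YangMills.Theorems.Prop7BlockPoincareTopMeanKept

open Literature.MathematicalPhysics.QuantumFieldTheory.Balaban1983to89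
open Finset
open T4Continuum BlockAveraging
open BlockAveraging (Idx)
open B7Prop1Explicit (U1 mem_U1 treeWord plaqWord disp)
open B7Eq78Linearization (conjR conjR_apply conjR_sub conjR_smul_real)
open B8Ineq132 (norm_conjR conjR_conjR one_conjR conjR_sum)
open B5Eq118OneStroke (iterBlockOf iterBlock mem_iterBlock iterBlock_zero sum_iterBlock_succ)
open B15DeterminingSets (embIter)
open B10Eq27TorusAxialLog (holT axialT transl unitsField toUField)
open B7TransferAnalyticMean (meanCLM)
open B5Leaf237C0Torus (sum_chart)
open Summit.QuantumFields.YangMills.Theorems.Prop7CovariantCoercivity (norm_conjR_sub_conjR_le hyp_of_specialUnitary)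
open Summit.QuantumFields.YangMills.Theorems.Prop8Chart (emlIterU)
open Summit.QuantumFields.YangMills.Theorems.Prop7NestedMeanPoincare
  (sum_normSq_le_combMean_add_covGrad normSq_toL2S_le_two_mul mul_sum_normSq_covGrad_le_normSq_DL2 conjR_unitsField_toUField
    hstep_of_hsucc norm_ns_sub_refMean_le_of_lt)

variable {N : ℕ} [NeZero N]

/-! ## §3 The T³ member: the displayed-data edition and the ROW-T-plugged edition of the kept-mean Poincaré inequality -/

section T3

open Literature.MathematicalPhysics.QuantumFieldTheory.Balaban1983to89.T3ContinuumYM3Torus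
open T3SectALandauChart (eta eta_pos bgUnits)
open T3RegularMinimiser (regThreshold)
open T3PrintedRegularMinimiser (RegPr)
open Summit.QuantumFields.YangMills.Theorems.Prop7SectET3HilbertLetters (toL2S DL2)
open Summit.QuantumFields.YangMills.Theorems.Prop7SymAvgTwSym (holT_mem_U1 unitsField_toUField_mem_U1' emlIterU_bgUnits_mem_U1_of_regPr)
open Summit.QuantumFields.YangMills.Theorems.Prop7NestedMeanTowerCloseness
  (ref_T3_mem_U1 ref_T3_zero_self hclose_T3 g_T3_mem_U1 htop_T3 two_mul_sum_eta_le_T3)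

variable (F : T3Family) {n K : ℕ}

/-- ★★ **THE KEPT-MEAN POINCARÉ INEQUALITY AT A PRINTED-REGULAR BACKGROUND, TOWER-CLOSENESS DATA DISPLAYED** (the all-`λ` twin of ✓`normSq_toL2S_le_two_mul_of_ns_eq_zero`).
`U₀ ∈ 𝔘_k(ε₀)` (`RegPr F n K ε₀ U₀`, `10⁷L³ε₀ ≤ 1`); `ns` the averaging sequence of `l` against the background tower (`h0`∕`hsucc` of ✓`QTwS_gaugeDir_of_avgSeq` VERBATIM);
DISPLAYED: unitary references `C_{j,z,x}` (`j ≤ K − n`, `C_{0,x,x} = 1`) with per-level closeness `η_j ≥ 0` and a top comparison `‖C_{K−n,y,x_r} − g_y·U₀♭(Γ_{ȳ,x_r})‖ ≤ η′`, in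
the window `108ε₀² + 8(2Σ_{j<K−n}η_j + 2η′)² ≤ 1`.  THEN, for EVERY `l` (no kernel condition):
**`‖toL2S l‖² ≤ 2·‖DL2 U₀ (toL2S l)‖² + 16·c₀·(L^{K−n})³·Σ_y ‖ns (K − n) y‖²`.**  (§2 gives `A_y = (L³)^{K−n}·‖ns_{K−n}(y)‖` in the socket above; `((L^{K−n})³)⁻¹·((L³)^{K−n})² = (L^{K−n})³`.)
[cite: Balaban1983RegularityDecay, (1.8) p.573, Prop 3.1′ (1.22) p.574; Balaban1985BackgroundPropagators, (3.19) p.393, (3.24) p.394, Thm 3.11 p.416; Balaban1985Averaging, (97) p.32] -/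
theorem normSq_toL2S_le_two_mul_add_of_ns {c₀ : ℝ} [Fact (0 < c₀)] {ε₀ : ℝ} (hε₀ : 0 < ε₀) (hε7 : 10 ^ 7 * (F.L : ℝ) ^ 3 * ε₀ ≤ 1)
    (U₀ : GaugeField (F.P K) 0 (Matrix.specialUnitaryGroup (Fin 2) ℂ)) (hreg : RegPr F n K ε₀ U₀)
    (ns : (j : ℕ) → Site (F.P K) j → Matrix (Fin 2) (Fin 2) ℂ) (l : Site (F.P K) 0 → Matrix (Fin 2) (Fin 2) ℂ) (h0 : ns 0 = l)
    (hsucc : ∀ (j : ℕ) (y : Site (F.P K) (j + 1)), ns (j + 1) y = ns j (emb y) - meanCLM (Idx (F.P K)) (Matrix (Fin 2) (Fin 2) ℂ) fun i : Idx (F.P K) =>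
        ns j (emb y) - ((holT (emlIterU j (bgUnits F K U₀)) (emb y) (stairWord i.2.1 (off i.1)) : (Matrix (Fin 2) (Fin 2) ℂ)ˣ) : Matrix (Fin 2) (Fin 2) ℂ) *
          ns j (transl (emb y) (disp (stairWord i.2.1 (off i.1)))) * (((holT (emlIterU j (bgUnits F K U₀)) (emb y) (stairWord i.2.1 (off i.1)))⁻¹ : (Matrix (Fin 2) (Fin 2) ℂ)ˣ) : Matrix (Fin 2) (Fin 2) ℂ))
    (C : (j : ℕ) → Site (F.P K) j → Site (F.P K) 0 → (Matrix (Fin 2) (Fin 2) ℂ)ˣ) (hC : ∀ j, j ≤ K - n → ∀ z x, C j z x ∈ U1 (Matrix (Fin 2) (Fin 2) ℂ))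
    (hC0 : ∀ x, C 0 x x = 1) (η : ℕ → ℝ) (hη : ∀ j, 0 ≤ η j)
    (hclose : ∀ j, j < K - n → ∀ (y : Site (F.P K) (j + 1)) (i : Idx (F.P K)), ∀ x ∈ iterBlock j (Site.blockSite y i.1),
      ‖((holT (emlIterU j (bgUnits F K U₀)) (emb y) (stairWord i.2.1 (off i.1)) : (Matrix (Fin 2) (Fin 2) ℂ)ˣ) : Matrix (Fin 2) (Fin 2) ℂ) *
          (C j (Site.blockSite y i.1) x : Matrix (Fin 2) (Fin 2) ℂ) - (C (j + 1) y x : Matrix (Fin 2) (Fin 2) ℂ)‖ ≤ η j)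
    (g : Site (F.P K) (K - n) → (Matrix (Fin 2) (Fin 2) ℂ)ˣ) (hg : ∀ y, g y ∈ U1 (Matrix (Fin 2) (Fin 2) ℂ)) {η' : ℝ} (hη' : 0 ≤ η')
    (htop : ∀ (y : Site (F.P K) (K - n)) (r : Fin (F.P K).d → Fin ((F.P K).L ^ (K - n))),
      ‖(C (K - n) y (Site.fibreSite 0 (K - n) y r) : Matrix (Fin 2) (Fin 2) ℂ) -
          (g y : Matrix (Fin 2) (Fin 2) ℂ) * ((holT (unitsField (toUField U₀)) (Site.fibreSite 0 (K - n) y fun _ => ⟨0, pow_pos (F.P K).L_pos (K - n)⟩)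
            (treeWord fun ν => ((r ν : ℕ) : ℤ)) : (Matrix (Fin 2) (Fin 2) ℂ)ˣ) : Matrix (Fin 2) (Fin 2) ℂ)‖ ≤ η')
    (hwin : 108 * ε₀ ^ 2 + 8 * (2 * ∑ j ∈ range (K - n), η j + 2 * η') ^ 2 ≤ 1) :
    ‖toL2S F K c₀ l‖ ^ 2 ≤ 2 * ‖DL2 F n K c₀ U₀ (toL2S F K c₀ l)‖ ^ 2
      + 16 * c₀ * ((F.L : ℝ) ^ (K - n)) ^ 3 * ∑ y : Site (F.P K) (K - n), ‖ns (K - n) y‖ ^ 2 := by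
  have hk₀ : K - n ≤ (F.P K).m + (F.P K).K := by
    show K - n ≤ F.m + K; have := F.hm; omega
  have hL0 : (0 : ℝ) < (F.L : ℝ) := by have := F.hL.2; exact_mod_cast (show 0 < F.L by omega)
  have hLF : ((F.P K).L : ℝ) = (F.L : ℝ) := by norm_cast
  have hdN : (F.P K).d = 3 := T3ContinuumYM3Torus.T3Family.P_d F K
  -- the plaquette row from `RegPr`
  have hU : ∀ p : Plaq (F.P K) 0, dist1 (GaugeField.plaqHol U₀ p) ≤ ε₀ * (((F.L : ℝ) ^ (K - n)) ^ 2)⁻¹ := by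
    intro p
    have h := hreg.plaqSmall p
    have e : regThreshold F n K ε₀ = ε₀ * (((F.L : ℝ) ^ (K - n)) ^ 2)⁻¹ := by
      unfold regThreshold; rw [inv_pow, ← pow_mul, mul_comm 2 (K - n), pow_mul]
    rw [e] at h
    exact h.le
  -- the transports: unitary below the top level
  set T : (j : ℕ) → Site (F.P K) (j + 1) → Idx (F.P K) → (Matrix (Fin 2) (Fin 2) ℂ)ˣ :=
    fun j y i => holT (emlIterU j (bgUnits F K U₀)) (emb y) (stairWord i.2.1 (off i.1)) with hTdef
  have hT : ∀ j, j < K - n → ∀ (y : Site (F.P K) (j + 1)) (i : Idx (F.P K)), T j y i ∈ U1 (Matrix (Fin 2) (Fin 2) ℂ) :=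
    fun j hj y i => holT_mem_U1 (fun b => emlIterU_bgUnits_mem_U1_of_regPr F hε₀ hε7 hreg hj.le b) _ _
  have hstep : ∀ j, j < K - n → ∀ (y : Site (F.P K) (j + 1)),
      ns (j + 1) y = ((Fintype.card (Idx (F.P K)) : ℝ)⁻¹) • ∑ i : Idx (F.P K), conjR (T j y i) (ns j (Site.blockSite y i.1)) :=
    fun j _ y => hstep_of_hsucc T ns hsucc j y
  -- the fine corner combs are unitary
  set W : Site (F.P K) (K - n) → (Fin (F.P K).d → Fin ((F.P K).L ^ (K - n))) → (Matrix (Fin 2) (Fin 2) ℂ)ˣ :=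
    fun y r => holT (unitsField (toUField U₀)) (Site.fibreSite 0 (K - n) y fun _ => ⟨0, pow_pos (F.P K).L_pos (K - n)⟩) (treeWord fun ν => ((r ν : ℕ) : ℤ)) with hWdef
  have hW : ∀ y r, W y r ∈ U1 (Matrix (Fin 2) (Fin 2) ℂ) := fun y r => holT_mem_U1 (fun b => unitsField_toUField_mem_U1' U₀ b) _ _
  have hδ0 : 0 ≤ 2 * ∑ j ∈ range (K - n), η j + 2 * η' := by
    have : 0 ≤ ∑ j ∈ range (K - n), η j := Finset.sum_nonneg fun j _ => hη j
    positivity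
  -- §2: the kept-mean comb bound with `A_y = (L^d)^{K−n}·‖ns_{K−n}(y)‖`
  have hcomb := fun y => norm_combSum_le_add_of_ns hk₀ T hT ns l (fun x => by rw [h0]) hstep C hC hC0 η hclose W hW g hg htop y
  have hA : ∀ y : Site (F.P K) (K - n), 0 ≤ ((((F.P K).L : ℝ) ^ (F.P K).d) ^ (K - n)) * ‖ns (K - n) y‖ := fun y => by
    have := (F.P K).L_pos; positivity
  have hsock := normSq_toL2S_le_two_mul_add_of_combMean_le F (n := n) (c₀ := c₀) U₀ hε₀.le hδ0 hwin hU l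
    (fun y => ((((F.P K).L : ℝ) ^ (F.P K).d) ^ (K - n)) * ‖ns (K - n) y‖) hA hcomb
  -- `((L^{K−n})³)⁻¹·((L³)^{K−n}·‖ns y‖)² = (L^{K−n})³·‖ns y‖²`
  have hLk : (0 : ℝ) < ((F.L : ℝ) ^ (K - n)) ^ 3 := by positivity
  have e3 : ∀ y : Site (F.P K) (K - n), ((((F.P K).L : ℝ) ^ (F.P K).d) ^ (K - n) * ‖ns (K - n) y‖) ^ 2
      = (((F.L : ℝ) ^ (K - n)) ^ 3) ^ 2 * ‖ns (K - n) y‖ ^ 2 := by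
    intro y
    rw [hLF, hdN]
    ring
  have e4 : 16 * c₀ * (((F.L : ℝ) ^ (K - n)) ^ 3)⁻¹ * ∑ y : Site (F.P K) (K - n), ((((F.P K).L : ℝ) ^ (F.P K).d) ^ (K - n) * ‖ns (K - n) y‖) ^ 2
      = 16 * c₀ * ((F.L : ℝ) ^ (K - n)) ^ 3 * ∑ y : Site (F.P K) (K - n), ‖ns (K - n) y‖ ^ 2 := by
    simp_rw [e3]
    rw [← Finset.mul_sum, ← mul_assoc]
    congr 1
    rw [sq, ← mul_assoc, mul_assoc (16 * c₀), inv_mul_cancel₀ hLk.ne', mul_one]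
  rw [e4] at hsock
  exact hsock

/-- ★★ **ON `𝔘_k(ε₀)`, THE KEPT-MEAN POINCARÉ INEQUALITY WITH NO DISPLAYED TOWER ROW**: `RegPr F n K ε₀ U₀`, `10⁷L³ε₀ ≤ 1`, `ns` the averaging sequence of `l` against `Ū₀♭`
(the `h0`∕`hsucc` of ✓`QTwS_gaugeDir_of_avgSeq` VERBATIM), NO condition on `ns (K − n)`:
**`‖toL2S l‖² ≤ 2·‖D^η_{U₀}(toL2S l)‖² + 16·c₀·(L^{K−n})³·Σ_y ‖ns (K − n) y‖²`** — the displayed-data edition with every row inhabited by ROW-T (corner-axial references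
✓`ref_T3_mem_U1`∕`ref_T3_zero_self`∕`hclose_T3`∕`g_T3_mem_U1`∕`htop_T3`, `η_j = 4500L²ε₀Lʲη`, `η′ = 0`, window `window8_T3`); the all-`λ` twin of
✓`normSq_toL2S_le_two_mul_of_nsTop_eq_zero`. [cite: Balaban1983RegularityDecay, (1.8) p.573, Prop 3.1′ (1.22) p.574; Balaban1985BackgroundPropagators, Thm 3.11 p.416, (3.19) p.393, (3.24) p.394; Balaban1985Averaging, (97) p.32; Balaban1985Variational, (2) p.278] -/
theorem normSq_toL2S_le_two_mul_add_of_nsTop {c₀ : ℝ} [Fact (0 < c₀)] {ε₀ : ℝ} (hε₀ : 0 < ε₀) (hε7 : 10 ^ 7 * (F.L : ℝ) ^ 3 * ε₀ ≤ 1)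
    (U₀ : GaugeField (F.P K) 0 (Matrix.specialUnitaryGroup (Fin 2) ℂ)) (hreg : RegPr F n K ε₀ U₀)
    (ns : (j : ℕ) → Site (F.P K) j → Matrix (Fin 2) (Fin 2) ℂ) (l : Site (F.P K) 0 → Matrix (Fin 2) (Fin 2) ℂ) (h0 : ns 0 = l)
    (hsucc : ∀ (j : ℕ) (y : Site (F.P K) (j + 1)), ns (j + 1) y = ns j (emb y) - meanCLM (Idx (F.P K)) (Matrix (Fin 2) (Fin 2) ℂ) fun i : Idx (F.P K) =>
        ns j (emb y) - ((holT (emlIterU j (bgUnits F K U₀)) (emb y) (stairWord i.2.1 (off i.1)) : (Matrix (Fin 2) (Fin 2) ℂ)ˣ) : Matrix (Fin 2) (Fin 2) ℂ) *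
          ns j (transl (emb y) (disp (stairWord i.2.1 (off i.1)))) * (((holT (emlIterU j (bgUnits F K U₀)) (emb y) (stairWord i.2.1 (off i.1)))⁻¹ : (Matrix (Fin 2) (Fin 2) ℂ)ˣ) : Matrix (Fin 2) (Fin 2) ℂ)) :
    ‖toL2S F K c₀ l‖ ^ 2 ≤ 2 * ‖DL2 F n K c₀ U₀ (toL2S F K c₀ l)‖ ^ 2
      + 16 * c₀ * ((F.L : ℝ) ^ (K - n)) ^ 3 * ∑ y : Site (F.P K) (K - n), ‖ns (K - n) y‖ ^ 2 :=
  normSq_toL2S_le_two_mul_add_of_ns F hε₀ hε7 U₀ hreg ns l h0 hsucc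
    (fun j z x => (axialT (bgUnits F K U₀) (Site.fibreSite 0 (K - n) (iterBlockOf (K - n) x) fun _ => (⟨0, pow_pos (F.P K).L_pos (K - n)⟩ : Fin ((F.P K).L ^ (K - n))))
        (embIter j z))⁻¹ *
      axialT (bgUnits F K U₀) (Site.fibreSite 0 (K - n) (iterBlockOf (K - n) x) fun _ => (⟨0, pow_pos (F.P K).L_pos (K - n)⟩ : Fin ((F.P K).L ^ (K - n)))) x)
    (fun j _ z x => ref_T3_mem_U1 F U₀ j z x) (fun x => ref_T3_zero_self F U₀ x)
    (fun j => 4500 * (F.L : ℝ) ^ 2 * ε₀ * ((F.L : ℝ) ^ j * eta F n K))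
    (fun j => by have := hε₀.le; have := (eta_pos F n K).le; positivity)
    (hclose_T3 F hε₀ hε7 U₀ hreg.plaqSmall)
    (fun y => (axialT (bgUnits F K U₀) (Site.fibreSite 0 (K - n) y fun _ => (⟨0, pow_pos (F.P K).L_pos (K - n)⟩ : Fin ((F.P K).L ^ (K - n)))) (embIter (K - n) y))⁻¹)
    (fun y => g_T3_mem_U1 F U₀ y) (le_refl (0 : ℝ)) (htop_T3 F U₀) (window8_T3 F hε₀ hε7)

end T3

/-! ## §4 The display: the gap of `Δ′_a = Δ_U + aQ″†Q″` on ALL `λ` for every top nested covariant mean `Q″` of record -/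

section Display

open Literature.MathematicalPhysics.QuantumFieldTheory.Balaban1983to89.T3ContinuumYM3Torus
open T3SectALandauChart (eta bgUnits)
open T3PrintedRegularMinimiser (RegPr)
open B9Eq311L2Pairing (WL2)
open B11Eq103H1Complex (SiteL2K)
open Summit.QuantumFields.YangMills.Theorems.Prop7SectET3Transport (periodsT3)
open Summit.QuantumFields.YangMills.Theorems.Prop7SectET3HilbertLetters (W₂ toL2S DL2)

variable (F : T3Family) {n K : ℕ}

/-- ★★★ **(L2′-GAP) — THE BLOCK COVARIANT POINCARÉ INEQUALITY WITH THE TOP NESTED COVARIANT MEAN KEPT, FOR ANY `Q″` OF RECORD, FROM `RegPr` ALONE, ON ALL `λ`.**  `Q''` is any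
`ℂ`-linear map with clauses (iii) and (iv) of ✓`exists_intertwiner_of_regPr` (the `hseq` of ✓`Prop7BlockPoincareKerTopMean.normSq_le_two_mul_normSq_DL2_of_topMean_eq_zero` VERBATIM:
every averaging sequence of `λ` has top `Q'' (toL2S λ)`, and one exists); then for EVERY `λ`
**`‖toL2S λ‖² ≤ 2·‖DL2 U₀ (toL2S λ)‖² + 16·c₀·(L^{K−n})³·Σ_y ‖(Q''(toL2S λ)) y‖²`** — the gap `Δ′_a ≥ min(½, a∕16)` of print's massive covariant operator in the lane's
weights (coarse weight `c₀η⁻³` = the isometric block-constant lift; constants free of `L`, `k = K − n`, volume).  (L1) ✓p746531 is the case `Q''(toL2S λ) = 0`.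
[cite: Balaban1983RegularityDecay, (1.8) p.573, Prop 3.1′ (1.22) p.574, (2.27) p.580; Balaban1985BackgroundPropagators, (3.24)–(3.25) p.394, Thm 3.11 p.416, (3.19) p.393; Balaban1984PropagatorsI, (1.42)–(1.44) pp.25–26] -/
theorem normSq_le_two_mul_normSq_DL2_add_topMean {c₀ : ℝ} [Fact (0 < c₀)] {ε₀ : ℝ} (hε₀ : 0 < ε₀) (hε7 : 10 ^ 7 * (F.L : ℝ) ^ 3 * ε₀ ≤ 1)
    (U₀ : GaugeField (F.P K) 0 (Matrix.specialUnitaryGroup (Fin 2) ℂ)) (hreg : RegPr F n K ε₀ U₀)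
    (Q'' : SiteL2K ℂ 3 (periodsT3 F K) c₀ W₂ →ₗ[ℂ] (Site (F.P K) (K - n) → Matrix (Fin 2) (Fin 2) ℂ))
    (hseq : ∀ lam : Site (F.P K) 0 → Matrix (Fin 2) (Fin 2) ℂ, ∃ ns : (j : ℕ) → Site (F.P K) j → Matrix (Fin 2) (Fin 2) ℂ, ns 0 = lam ∧
        (∀ (j : ℕ) (y : Site (F.P K) (j + 1)), ns (j + 1) y = ns j (emb y) - meanCLM (Idx (F.P K)) (Matrix (Fin 2) (Fin 2) ℂ) fun i : Idx (F.P K) =>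
          ns j (emb y) - ((holT (emlIterU j (bgUnits F K U₀)) (emb y) (stairWord i.2.1 (off i.1)) : (Matrix (Fin 2) (Fin 2) ℂ)ˣ) : Matrix (Fin 2) (Fin 2) ℂ) *
            ns j (transl (emb y) (disp (stairWord i.2.1 (off i.1)))) * (((holT (emlIterU j (bgUnits F K U₀)) (emb y) (stairWord i.2.1 (off i.1)))⁻¹ : (Matrix (Fin 2) (Fin 2) ℂ)ˣ) : Matrix (Fin 2) (Fin 2) ℂ)) ∧
        ns (K - n) = Q'' (toL2S F K c₀ lam)) :
    ∀ lam : Site (F.P K) 0 → Matrix (Fin 2) (Fin 2) ℂ,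
      ‖toL2S F K c₀ lam‖ ^ 2 ≤ 2 * ‖DL2 F n K c₀ U₀ (toL2S F K c₀ lam)‖ ^ 2
        + 16 * c₀ * ((F.L : ℝ) ^ (K - n)) ^ 3 * ∑ y : Site (F.P K) (K - n), ‖Q'' (toL2S F K c₀ lam) y‖ ^ 2 := by
  intro lam
  obtain ⟨ns, h0, hsucc, htop⟩ := hseq lam
  have h := normSq_toL2S_le_two_mul_add_of_nsTop F (c₀ := c₀) hε₀ hε7 U₀ hreg ns lam h0 hsucc
  rw [htop] at h
  exact h

/-- ★ **FROBENIUS TWIN ON THE COARSE SIDE**: the same with `Σ_y Σ_{jk} |(Q''(toL2S λ)) y j k|²` (the natural `ℓ²(sites ⊗ M₂)` letter once a coarse inner product is fixed;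
`‖X‖_op² ≤ Σ_{jk}|X_{jk}|²` ✓`MatrixNorms.opNorm_sq_le_sum_norm_sq`, so the constant 16 is unchanged). [cite: Balaban1985BackgroundPropagators, (3.11) p.392, (3.24) p.394; Balaban1983RegularityDecay, (1.8) p.573] -/
theorem normSq_le_two_mul_normSq_DL2_add_topMean_frob {c₀ : ℝ} [Fact (0 < c₀)] {ε₀ : ℝ} (hε₀ : 0 < ε₀) (hε7 : 10 ^ 7 * (F.L : ℝ) ^ 3 * ε₀ ≤ 1)
    (U₀ : GaugeField (F.P K) 0 (Matrix.specialUnitaryGroup (Fin 2) ℂ)) (hreg : RegPr F n K ε₀ U₀)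
    (Q'' : SiteL2K ℂ 3 (periodsT3 F K) c₀ W₂ →ₗ[ℂ] (Site (F.P K) (K - n) → Matrix (Fin 2) (Fin 2) ℂ))
    (hseq : ∀ lam : Site (F.P K) 0 → Matrix (Fin 2) (Fin 2) ℂ, ∃ ns : (j : ℕ) → Site (F.P K) j → Matrix (Fin 2) (Fin 2) ℂ, ns 0 = lam ∧
        (∀ (j : ℕ) (y : Site (F.P K) (j + 1)), ns (j + 1) y = ns j (emb y) - meanCLM (Idx (F.P K)) (Matrix (Fin 2) (Fin 2) ℂ) fun i : Idx (F.P K) =>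
          ns j (emb y) - ((holT (emlIterU j (bgUnits F K U₀)) (emb y) (stairWord i.2.1 (off i.1)) : (Matrix (Fin 2) (Fin 2) ℂ)ˣ) : Matrix (Fin 2) (Fin 2) ℂ) *
            ns j (transl (emb y) (disp (stairWord i.2.1 (off i.1)))) * (((holT (emlIterU j (bgUnits F K U₀)) (emb y) (stairWord i.2.1 (off i.1)))⁻¹ : (Matrix (Fin 2) (Fin 2) ℂ)ˣ) : Matrix (Fin 2) (Fin 2) ℂ)) ∧
        ns (K - n) = Q'' (toL2S F K c₀ lam)) :
    ∀ lam : Site (F.P K) 0 → Matrix (Fin 2) (Fin 2) ℂ,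
      ‖toL2S F K c₀ lam‖ ^ 2 ≤ 2 * ‖DL2 F n K c₀ U₀ (toL2S F K c₀ lam)‖ ^ 2
        + 16 * c₀ * ((F.L : ℝ) ^ (K - n)) ^ 3 * ∑ y : Site (F.P K) (K - n), ∑ j : Fin 2, ∑ k : Fin 2, ‖Q'' (toL2S F K c₀ lam) y j k‖ ^ 2 := by
  intro lam
  have h := normSq_le_two_mul_normSq_DL2_add_topMean F hε₀ hε7 U₀ hreg Q'' hseq lam
  have hc : 0 < c₀ := Fact.out
  have hLpos : (0 : ℝ) < F.L := by have := F.hL.2; exact_mod_cast (by omega : 0 < F.L)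
  have hop : ∑ y : Site (F.P K) (K - n), ‖Q'' (toL2S F K c₀ lam) y‖ ^ 2
      ≤ ∑ y : Site (F.P K) (K - n), ∑ j : Fin 2, ∑ k : Fin 2, ‖Q'' (toL2S F K c₀ lam) y j k‖ ^ 2 :=
    Finset.sum_le_sum fun y _ => MatrixNorms.opNorm_sq_le_sum_norm_sq (Q'' (toL2S F K c₀ lam) y)
  have h16 : (0 : ℝ) ≤ 16 * c₀ * ((F.L : ℝ) ^ (K - n)) ^ 3 := by positivity
  have := mul_le_mul_of_nonneg_left hop h16
  linarith

/-- ★★ **THE GAP FORM** `Δ′_a ≥ min(½, a∕16)`: for every `a > 0` and every `λ`,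
`‖toL2S λ‖² ≤ max(2, 16·c₀·(L^{K−n})³ ∕ a) · (‖DL2 U₀ (toL2S λ)‖² + a·Σ_y ‖(Q''(toL2S λ)) y‖²)` — the K-uniform lower bound of print's massive covariant operator
`Δ′_a = Δ^η_U + Q′*aQ′` ((3.24)) in the lane's weights (at print's normalisation `c₀ = η³` the constant is `max(2, 16∕a)`).
[cite: Balaban1983RegularityDecay, (1.8) p.573, Prop 3.1′ (1.22) p.574; Balaban1985BackgroundPropagators, (3.24) p.394, Thm 3.11 p.416; Balaban1984PropagatorsI, (1.42) p.25] -/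
theorem gap_of_topMean {c₀ : ℝ} [Fact (0 < c₀)] {ε₀ : ℝ} (hε₀ : 0 < ε₀) (hε7 : 10 ^ 7 * (F.L : ℝ) ^ 3 * ε₀ ≤ 1)
    (U₀ : GaugeField (F.P K) 0 (Matrix.specialUnitaryGroup (Fin 2) ℂ)) (hreg : RegPr F n K ε₀ U₀)
    (Q'' : SiteL2K ℂ 3 (periodsT3 F K) c₀ W₂ →ₗ[ℂ] (Site (F.P K) (K - n) → Matrix (Fin 2) (Fin 2) ℂ))
    (hseq : ∀ lam : Site (F.P K) 0 → Matrix (Fin 2) (Fin 2) ℂ, ∃ ns : (j : ℕ) → Site (F.P K) j → Matrix (Fin 2) (Fin 2) ℂ, ns 0 = lam ∧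
        (∀ (j : ℕ) (y : Site (F.P K) (j + 1)), ns (j + 1) y = ns j (emb y) - meanCLM (Idx (F.P K)) (Matrix (Fin 2) (Fin 2) ℂ) fun i : Idx (F.P K) =>
          ns j (emb y) - ((holT (emlIterU j (bgUnits F K U₀)) (emb y) (stairWord i.2.1 (off i.1)) : (Matrix (Fin 2) (Fin 2) ℂ)ˣ) : Matrix (Fin 2) (Fin 2) ℂ) *
            ns j (transl (emb y) (disp (stairWord i.2.1 (off i.1)))) * (((holT (emlIterU j (bgUnits F K U₀)) (emb y) (stairWord i.2.1 (off i.1)))⁻¹ : (Matrix (Fin 2) (Fin 2) ℂ)ˣ) : Matrix (Fin 2) (Fin 2) ℂ)) ∧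
        ns (K - n) = Q'' (toL2S F K c₀ lam))
    {a : ℝ} (ha : 0 < a) :
    ∀ lam : Site (F.P K) 0 → Matrix (Fin 2) (Fin 2) ℂ,
      ‖toL2S F K c₀ lam‖ ^ 2 ≤ max 2 (16 * c₀ * ((F.L : ℝ) ^ (K - n)) ^ 3 / a) *
        (‖DL2 F n K c₀ U₀ (toL2S F K c₀ lam)‖ ^ 2 + a * ∑ y : Site (F.P K) (K - n), ‖Q'' (toL2S F K c₀ lam) y‖ ^ 2) := by
  intro lam
  have h := normSq_le_two_mul_normSq_DL2_add_topMean F hε₀ hε7 U₀ hreg Q'' hseq lam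
  have hc : 0 < c₀ := Fact.out
  have hLpos : (0 : ℝ) < F.L := by have := F.hL.2; exact_mod_cast (by omega : 0 < F.L)
  set Mx : ℝ := max 2 (16 * c₀ * ((F.L : ℝ) ^ (K - n)) ^ 3 / a) with hMx
  set D : ℝ := ‖DL2 F n K c₀ U₀ (toL2S F K c₀ lam)‖ ^ 2 with hD
  set S : ℝ := ∑ y : Site (F.P K) (K - n), ‖Q'' (toL2S F K c₀ lam) y‖ ^ 2 with hS
  have hD0 : 0 ≤ D := sq_nonneg _
  have hS0 : 0 ≤ S := Finset.sum_nonneg fun _ _ => sq_nonneg _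
  have h2 : (2 : ℝ) ≤ Mx := le_max_left _ _
  have h16 : 16 * c₀ * ((F.L : ℝ) ^ (K - n)) ^ 3 ≤ Mx * a := by
    have := le_max_right 2 (16 * c₀ * ((F.L : ℝ) ^ (K - n)) ^ 3 / a)
    rw [← hMx] at this
    rwa [div_le_iff₀ ha] at this
  calc ‖toL2S F K c₀ lam‖ ^ 2 ≤ 2 * D + 16 * c₀ * ((F.L : ℝ) ^ (K - n)) ^ 3 * S := h
    _ ≤ Mx * D + Mx * a * S := add_le_add (mul_le_mul_of_nonneg_right h2 hD0) (mul_le_mul_of_nonneg_right h16 hS0)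
    _ = Mx * (D + a * S) := by ring

end Display

end Summit.QuantumFields.YangMills.Theorems.Prop7BlockPoincareTopMeanKept

end
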